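import Literature.MathematicalPhysics.QuantumFieldTheory.Balaban1983to89.Node00.Record13NumericsOfThm1CCMWZB
import Literature.MathematicalPhysics.QuantumFieldTheory.Balaban1983to89.Node00.Record13LettersOfThm1CCMWZ
import Literature.MathematicalPhysics.QuantumFieldTheory.Balaban1983to89.Node00.Record13SignFreeComparabilityOfBetaBox

/-!
# NODE 00 (YM-PLAN Track A) — STAGE 13: THE LETTERS OF THE GAUGE ROAD AT THE εbg-LETTER WITNESS FAMILY «Z3»
# `θ₁₅ᶜᶜᴹᵂᶻᴮ(j; γ; εbg) = theta13OfThm1CCMWZB F N j γ εbg ε₀ ε₂₉ B₃ B₃' a₀ a₁ Efl logz` (`0 < γ ≤ ½`, background radius `εbg` OPEN), THE PINS, THE β TRANSFER TO THE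
# HALF-WINDOW MEMBER `θ₁₅ᶜᶜᴹᵂᶻᴮ(j; ½; εbg)` AND THE TWO HISTORY CLAUSES — A2ʷ-Z (`Record13LettersOfThm1CCMWZ`) RE-ISSUED BY TOKEN-PASS WITH `εbg` THREADED; the landed A2ʷ-Z letters
# are the `εbg = 1` instances (Z3's bridge `theta13OfThm1CCMWZ_eq_B`, `rfl`), the print-regime member is `εbg := a₀` (Z3 §5)

Cell `ym-nodeO-ideate`, DEFINER seat `ym-nodeO-def-1` (gen 28; author lineage of Z1 ∕ Z2 ∕ Z3 and of `Summits/…/BalabanUVNodesK1ZBWitnessBetaRadius`).  FILE A2ʷ-ZB.  NEW leaf, theorems only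
(0 `def`); Z3 `Record13NumericsOfThm1CCMWZB` (DEF-1 g10, p646340 ∕ p655338), A2ʷ-Z `Record13LettersOfThm1CCMWZ` (dag-n11-w5 g3), A2ʷ `Record13LettersOfThm1CCMW` (dag-n21-c), A2, A1ʷ and
node00-def-K0a's θ-generic files 13b ∕ 13e ∕ 14d ∕ 14 CONSUMED BY NAME, nothing modified.  `--kind proof --supports stmt-QuantumFields-20541` (K0⁷; count-neutral).
[15] = [Balaban1985Variational], [6] = [Balaban1985RegularSpaces], [III] = [Balaban1988Convergent], [I] = [Balaban1987RG1], [II] = [Balaban1989LargeFieldII], [IV] = [Balaban1989LargeFieldI].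

WHY THIS FILE.  DEF-1 g27's located answer `K1ZBWitnessBetaRadius` (p685339; pub-ymgap bus 2026-08-29 01:17Z): the β-functions of record READ the background radius — `betaOfRecord₁₃ θ`
goes through the merged term (1.6) at the background minimiser `Uk … θ.εbg …` — so the K0 witnesses of record (`εbg = 1`, OUTSIDE [B11] Thm 1's regime `ε ≤ a₀` under the guard
`217·a₀ ≤ 2`) and the print-regime member `θ₁₅ᶜᶜᴹᵂᶻᴮ(j; γ; a₀)` (Z3 §5: `εbg ≤ a₀`, `ν.εreg ≤ εbg` by `le_rfl`; N09's tower `…N09TowerOfNumericsAtThm1CCMWZB` reads it) carry DIFFERENT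
β's, and no `rfl` bridge moves a β-box between them.  The adopted repair (dag-n24-c g14 HOURLY-3, 02:04Z: «K0's stub 3 ∕ box re-stated at `εbg := a₀`») needs the K0 BODY re-derived at
the Z3 member; that body (k0-s1-w3 `…K0AllTorusOfStepTokensGuarded` §1 `bgAtDatumCoP_of_thm1RegSepCoP7MG_of_thm1GaugeG_allTorus`, θ-GENERIC) reads at the witness exactly the
WITNESS-LEVEL LETTERS `hnum_ ∕ εreg_le_ ∕ hBα_ ∕ htI_ ∕ htMS_ ∕ hC1_ ∕ M₁_pos_ ∕ τ9_M_pos_ ∕ hM_ ∕ hcomp_ ∕ hcompRev_…`, which exist for the `εbg = 1` members only (A2ʷ, A2ʷ-Z).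
THIS FILE re-issues them at the Z3 family, proof for proof.  Every letter of §3–§4 reads the numerics `ν, s2, τ9, γ, A₁`, the large-field constants and the running couplings UNDER THE
WINDOW HYPOTHESIS `Step.InInterval γ n (gOfRecord₁₃ θ p)` — never a value of β — so A2ʷ-Z's proof terms elaborate verbatim at `θ₁₅ᶜᶜᴹᵂᶻᴮ` (the numerics are `εbg`-blind: Z3's faces
`theta13OfThm1CCMWZB_ν_eq ∕ _εreg ∕ _A₀ ∕ _p₀ ∕ _r ∕ _M₁ ∕ _cB ∕ _B ∕ _C ∕ _Mr ∕ _cR ∕ _βc ∕ _τ9_M ∕ _γ`, `rfl`); the β TRANSFER of §5 compares the `γ`-window and the `½`-window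
members AT THE SAME `εbg` (both read ONE merged β on `]0, γ] ⊆ ]0, ½]`, `betaOfMerged_of_mem`), and §6's history clauses are derived from the β-box OF THE Z3 MEMBER ITSELF (13e ∕ 14d are
θ-generic).  GENERATED from the TREE text of A2ʷ-Z by the token pass `theta13OfThm1CCMWZ … γ ε₀ … ↦ theta13OfThm1CCMWZB … γ εbg ε₀ …`, `theta13OfThm1CCMZ … j ε₀ … ↦
theta13OfThm1CCMWZB … j (1 / 2) εbg ε₀ …` (Z3 `theta13OfThm1CCMZ_eq_B`: A1's collared witness IS the `(γ, εbg) = (½, 1)` member), declared names `…CCMWZ… ↦ …CCMWZB…`; A2's window-blind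
CCM lemmas (`τ9_M_pos_ ∕ M₁_pos_ ∕ collar_le_M₁_ ∕ hsN_ ∕ exists_wrap_ ∕ not_hsN_ ∕ hsN_…_iff ∕ mul_A0_nonneg_ ∕ gauge_mul_A0_nonneg_thm1CCM`) are invoked UNCHANGED (their conclusions are
the Z3 member's by `rfl` on the projections, exactly as A2ʷ-Z invokes them).  A2ʷ's generic `betaBox_restrict_of_le` and Z3's faces are NOT re-declared (cited by name).

WHAT THIS FILE PROVES (theorems only; 0 `def`).
* §0 the one face Z3 does not print: `lfOfRecord₁₂_theta13OfThm1CCMWZB` (`rfl`).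
* §3 the gauge-road letters along every `γ`-windowed run, `γ ≤ ½`: `hnum_`, `εreg_le_`, `hε0_`, `hg_`, `hpq_`, `hα0_`, `hBα_`, `hC1_`, `hcomp_…_of_monotone`, `htI_`, `htMS_`
  (`…theta13OfThm1CCMWZB`) + the `γ`-blind constant inequalities `mul_A0_nonneg_thm1CCMWZB ∕ mul_A0_le_C₀_thm1CCMWZB ∕ gauge_mul_A0_…_thm1CCMWZB`.
* §4 the pins and the collar ∕ non-wrapping letters: `τ9_M_pos_ ∕ M₁_pos_ ∕ hM_ ∕ hM₁_ ∕ collar_le_M₁_theta13OfThm1CCMWZB(') ∕ hsN_theta13OfThm1CCMWZB (hjm : j + 1 ≤ F.m) ∕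
  exists_wrap_…_of_le ∕ not_hsN_…_of_le ∕ hsN_theta13OfThm1CCMWZB_iff`.
* §5 the β transfer `betaOfRecord₁₃_theta13OfThm1CCMWZB_eq_of_mem : β₁₃(θ₁₅ᶜᶜᴹᵂᶻᴮ(j; γ; εbg)) k v = β₁₃(θ₁₅ᶜᶜᴹᵂᶻᴮ(j; ½; εbg)) k v` on `]0, γ]` (SAME `εbg, Efl, logz` on both sides) and the
  four `BetaLowerH ∕ BetaUpperH` transports; §6 the two history clauses `hmono_ ∕ hcomp_ ∕ hcompRev_…` from the β-box, and from the β-box of the half-window member on `]0, γ]`.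
* §6′ the SIGN-FREE pair `hcompBoth_theta13OfThm1CCMWZB_of_betaBoxSignFree(_half)` (box `bₗ ≤ β ≤ β′` of any sign, letters `−bₗ·γ² ≤ 3`, `β′·γ² ≤ ¾`; node O P3 g48's §4ʷ at Z3 over the θ-generic `Stage13Params.hcompBoth_of_betaBoxSignFree`) — the pair k0-s1's `clausesH_of_absBox` reads.
* §7 kernel SANITY (`example`s, nothing declared): at `εbg := 1` the letters ARE A2ʷ-Z's statements (Z3 bridge, `rfl`); at `εbg := a₀` they are the print-regime member's.

HONEST FRAMING.  Token-pass re-issue (one-line instantiations, a `rfl`-level transfer, elementary arithmetic) of LANDED content at DEF-1's definition edition Z3; nothing of Bałaban asserted;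
NOT a discharge; no value of `εbg` pinned for anybody (a LETTER throughout; `εbg := a₀` appears only in §7's sanity line); the K0 BODY at the Z3 member, K0⁷'s stub texts (V21-G
1d9e17422df218f7 of record: 0∕2, texts untouched) and any re-registration are the k0 lanes' ∕ the plan's, NOT this file's; [B11] Thm 1 ∕ `UkExists` ∕ orbit agreement NAMED nowhere here;
FLAG №7 (N09) NOT closed; K0⁷ stmt-QuantumFields-20541 ∕ K1⁹ 27364 ∕ K3⁸ 27366 OPEN; counts unmoved (typed 28∕28 · discharged 8∕28); one finite 𝕋⁴ programme at fixed ε — NOT continuum ∕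
ℝ⁴ ∕ OS; R4 = the conditional finite-𝕋⁴ rung `BalabanLadder.UV` only; the Yang–Mills mass gap (Clay) is NOT proved by any of this.  No `sorry`, no `axiom`, no `def`, no `instance`, no `notation`.
-/

noncomputable section

open MeasureTheory
open scoped Matrix.Norms.L2Operator

namespace Literature.MathematicalPhysics.QuantumFieldTheory.Balaban1983to89.Node00

open T4Continuum B14.Eq218Concrete B15DeterminingSets B12RegularSpaces111 B14RegularSpaces234 FlowStep FlowStepRuns

/-! ## §0. The one window-blind face of `θ₁₅ᶜᶜᴹᵂᶻᴮ(j; γ; εbg)` A2ʷ's proofs read that Z3 does not already print: the large-field letters (`rfl`). The numerics faces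
`theta13OfThm1CCMWZB_εreg ∕ _A₀ ∕ _p₀ ∕ _r ∕ _M₁ ∕ _cB ∕ _B ∕ _C ∕ _Mr ∕ _cR ∕ _βc ∕ _τ9_M ∕ _γ` are Z3's (`Record13NumericsOfThm1CCMWZB` §3), cited by name below. -/

section FacesZ

variable (F : T4Family) (N : ℕ) [NeZero N] (j : ℕ) (γ εbg ε₀ ε₂₉ B₃ B₃' a₀ a₁ : ℝ) (Efl logz : B12.RunParams → ℕ → ℝ)

/-- The large-field letters of record at `θ₁₅ᶜᶜᴹᵂᶻᴮ(j; γ; εbg)`: the family's constants with the window `γ` (`rfl`; A1ʷ's `lfOfRecord₁₂_theta13OfThm1CCMW`, token-pass). [cite: Balaban1988Convergent, (2.28) p.259 (bookkeeping)] -/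
theorem lfOfRecord₁₂_theta13OfThm1CCMWZB :
    lfOfRecord₁₂ F N (theta13OfThm1CCMWZB F N j γ εbg ε₀ ε₂₉ B₃ B₃' a₀ a₁ Efl logz).toStage12Params = { lfConstsOfFamily with γ := γ } := rfl

end FacesZ

/-! ## §3. The letters of the GAUGE road at `θ₁₅ᶜᶜᴹᵂᶻᴮ(j; γ; εbg)`, along every `γ`-windowed run, `γ ≤ ½` -/

section Faces

variable {F : T4Family} {N : ℕ} [NeZero N] {j : ℕ} {γ εbg ε₀ ε₂₉ B₃ B₃' a₀ a₁ : ℝ} {Efl logz : B12.RunParams → ℕ → ℝ}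

/-- **(hnum) AT `θ₁₅ᶜᶜᴹᵂᶻᴮ(j; γ; εbg)`** (`γ ≤ ½ < 1`): `0 < cR·ε_m ≤ a₁`, `B₃·cR·ε_m ≤ εreg = a₀` along every windowed run (13a's window lemma; thresholds window-blind).
[cite: Balaban1988Convergent, (2.4) p.255, (2.12) p.256; Balaban1985Variational, Thm 1 (7)–(8) p.279] -/
theorem hnum_theta13OfThm1CCMWZB (hγ : γ ≤ 1 / 2) (hB : 0 ≤ B₃) (hB' : 0 ≤ B₃') (ha₀ : 0 < a₀) (ha₁ : 0 < a₁) :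
     ∀ (p : B12.RunParams) (n : ℕ), n ≤ p.K → Step.InInterval (theta13OfThm1CCMWZB F N j γ εbg ε₀ ε₂₉ B₃ B₃' a₀ a₁ Efl logz).γ n (gOfRecord₁₃ F N (theta13OfThm1CCMWZB F N j γ εbg ε₀ ε₂₉ B₃ B₃' a₀ a₁ Efl logz) p) → ∀ m, m ≤ n →
      0 < (theta13OfThm1CCMWZB F N j γ εbg ε₀ ε₂₉ B₃ B₃' a₀ a₁ Efl logz).s2.cR * epsOfRecord (theta13OfThm1CCMWZB F N j γ εbg ε₀ ε₂₉ B₃ B₃' a₀ a₁ Efl logz).ν (gOfRecord₁₃ F N (theta13OfThm1CCMWZB F N j γ εbg ε₀ ε₂₉ B₃ B₃' a₀ a₁ Efl logz) p) m ∧ (theta13OfThm1CCMWZB F N j γ εbg ε₀ ε₂₉ B₃ B₃' a₀ a₁ Efl logz).s2.cR * epsOfRecord (theta13OfThm1CCMWZB F N j γ εbg ε₀ ε₂₉ B₃ B₃' a₀ a₁ Efl logz).ν (gOfRecord₁₃ F N (theta13OfThm1CCMWZB F N j γ εbg ε₀ ε₂₉ B₃ B₃' a₀ a₁ Efl logz)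 p) m ≤ a₁ ∧
        B₃ * ((theta13OfThm1CCMWZB F N j γ εbg ε₀ ε₂₉ B₃ B₃' a₀ a₁ Efl logz).s2.cR * epsOfRecord (theta13OfThm1CCMWZB F N j γ εbg ε₀ ε₂₉ B₃ B₃' a₀ a₁ Efl logz).ν (gOfRecord₁₃ F N (theta13OfThm1CCMWZB F N j γ εbg ε₀ ε₂₉ B₃ B₃' a₀ a₁ Efl logz) p) m) ≤ (theta13OfThm1CCMWZB F N j γ εbg ε₀ ε₂₉ B₃ B₃' a₀ a₁ Efl logz).ν.εreg :=
  fun _ _ _ hw => numerics_thm1CC1_of_inInterval (L := F.L) (ε₀ := ε₀) hB hB' ha₀ ha₁ (hγ.trans_lt (by norm_num) : γ < 1) hw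

/-- `θ₁₅ᶜᶜᴹᵂᶻᴮ(j; γ; εbg).ν.εreg ≤ a₀` (it IS `a₀`). [cite: Balaban1985Variational, Thm 1 (8) p.279 (bookkeeping)] -/
theorem εreg_le_theta13OfThm1CCMWZB : (theta13OfThm1CCMWZB F N j γ εbg ε₀ ε₂₉ B₃ B₃' a₀ a₁ Efl logz).ν.εreg ≤ a₀ := (theta13OfThm1CCMWZB_εreg F N j γ εbg ε₀ ε₂₉ B₃ B₃' a₀ a₁ Efl logz).le

/-- **`0 ≤ cR·ε_m` AT `θ₁₅ᶜᶜᴹᵂᶻᴮ(j; γ; εbg)`** along every windowed run. [cite: Balaban1988Convergent, (2.4) p.255, (2.10) p.256 (bookkeeping)] -/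
theorem hε0_theta13OfThm1CCMWZB (hγ : γ ≤ 1 / 2) (hB : 0 ≤ B₃) (hB' : 0 ≤ B₃') (ha₀ : 0 < a₀) (ha₁ : 0 < a₁) :
     ∀ (p : B12.RunParams) (n : ℕ), n ≤ p.K → Step.InInterval (theta13OfThm1CCMWZB F N j γ εbg ε₀ ε₂₉ B₃ B₃' a₀ a₁ Efl logz).γ n (gOfRecord₁₃ F N (theta13OfThm1CCMWZB F N j γ εbg ε₀ ε₂₉ B₃ B₃' a₀ a₁ Efl logz) p) → ∀ m, m ≤ n → 0 ≤ (theta13OfThm1CCMWZB F N j γ εbg ε₀ ε₂₉ B₃ B₃' a₀ a₁ Efl logz).s2.cR * epsOfRecord (theta13OfThm1CCMWZB F N j γ εbg ε₀ ε₂₉ B₃ B₃' a₀ a₁ Efl logz).ν (gOfRecord₁₃ F N (theta13OfThm1CCMWZB F N j γ εbg ε₀ ε₂₉ B₃ B₃' a₀ a₁ Efl logz) p) m :=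
  fun p n hn hw m hm => (hnum_theta13OfThm1CCMWZB hγ hB hB' ha₀ ha₁ p n hn hw m hm).1.le

/-- **THE WINDOW LETTERS AT `θ₁₅ᶜᶜᴹᵂᶻᴮ(j; γ; εbg)`** (`γ ≤ ½`): `0 < g_m`, `g_m² ≤ e⁻¹` along every windowed run. [cite: Balaban1987RG1, Thm 1 p.259; Balaban1988Convergent, (2.4) p.255 (bookkeeping)] -/
theorem hg_theta13OfThm1CCMWZB (hγ : γ ≤ 1 / 2) :
     ∀ (p : B12.RunParams) (n : ℕ), n ≤ p.K → Step.InInterval (theta13OfThm1CCMWZB F N j γ εbg ε₀ ε₂₉ B₃ B₃' a₀ a₁ Efl logz).γ n (gOfRecord₁₃ F N (theta13OfThm1CCMWZB F N j γ εbg ε₀ ε₂₉ B₃ B₃' a₀ a₁ Efl logz) p) → ∀ m, m ≤ n → 0 < gOfRecord₁₃ F N (theta13OfThm1CCMWZB F N j γ εbg ε₀ ε₂₉ B₃ B₃' a₀ a₁ Efl logz) p m ∧ gOfRecord₁₃ F N (theta13OfThm1CCMWZB F N j γ εbg ε₀ ε₂₉ B₃ B₃' a₀ a₁ Efl logz) p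 m ^ 2 ≤ Real.exp (-1) :=
  fun _ _ _ hw => window_sq_le_of_inInterval ((theta13OfThm1CCMWZB_γ F N j γ εbg ε₀ ε₂₉ B₃ B₃' a₀ a₁ Efl logz).trans_le hγ) hw

/-- **`p₀ ≤ q₀` AT `θ₁₅ᶜᶜᴹᵂᶻᴮ(j; γ; εbg)`** (`1 ≤ 2`). [cite: Balaban1988Convergent, (2.4) p.255, (2.28) p.259 (bookkeeping)] -/
theorem hpq_theta13OfThm1CCMWZB : (theta13OfThm1CCMWZB F N j γ εbg ε₀ ε₂₉ B₃ B₃' a₀ a₁ Efl logz).ν.p₀ ≤ (lfOfRecord₁₂ F N (theta13OfThm1CCMWZB F N j γ εbg ε₀ ε₂₉ B₃ B₃' a₀ a₁ Efl logz).toStage12Params).q₀ := by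
  rw [theta13OfThm1CCMWZB_p₀, lfOfRecord₁₂_theta13OfThm1CCMWZB]; norm_num [lfConstsOfFamily, lfConstsOfRecord₁₂]

/-- **`α₀(g_m) > 0` AT `θ₁₅ᶜᶜᴹᵂᶻᴮ(j; γ; εbg)`** along every windowed run (`C₀ = 1 > 0`, `0 < g_m ≤ γ ≤ ½ < 1`). [cite: Balaban1988Convergent, (2.28) p.259 (bookkeeping)] -/
theorem hα0_theta13OfThm1CCMWZB (hγ : γ ≤ 1 / 2) :
    ∀ (p : B12.RunParams) (n : ℕ), n ≤ p.K → Step.InInterval (theta13OfThm1CCMWZB F N j γ εbg ε₀ ε₂₉ B₃ B₃' a₀ a₁ Efl logz).γ n (gOfRecord₁₃ F N (theta13OfThm1CCMWZB F N j γ εbg ε₀ ε₂₉ B₃ B₃' a₀ a₁ Efl logz) p) → ∀ m, m ≤ n →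
      0 < (lfOfRecord₁₂ F N (theta13OfThm1CCMWZB F N j γ εbg ε₀ ε₂₉ B₃ B₃' a₀ a₁ Efl logz).toStage12Params).alpha0 (gOfRecord₁₃ F N (theta13OfThm1CCMWZB F N j γ εbg ε₀ ε₂₉ B₃ B₃' a₀ a₁ Efl logz) p m) :=
  fun p n _ hw m hm => alpha0_pos_of_lt_one _ (by rw [lfOfRecord₁₂_theta13OfThm1CCMWZB]; norm_num [lfConstsOfFamily, lfConstsOfRecord₁₂]) (hw m hm).1
    ((hw m hm).2.trans_lt ((theta13OfThm1CCMWZB_γ F N j γ εbg ε₀ ε₂₉ B₃ B₃' a₀ a₁ Efl logz).trans_lt (hγ.trans_lt (by norm_num))))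

/-- `0 ≤ B₃·cR·A₀` at `θ₁₅ᶜᶜᴹᵂᶻᴮ(j; γ; εbg)` (window-blind: A2's at `θ₁₅ᶜᶜᴹ(j)`). [cite: Balaban1988Convergent, (2.28) p.259 (bookkeeping)] -/
theorem mul_A0_nonneg_thm1CCMWZB (hB : 0 ≤ B₃) (hB' : 0 ≤ B₃') (ha₀ : 0 ≤ a₀) (ha₁ : 0 ≤ a₁) :
    0 ≤ B₃ * (theta13OfThm1CCMWZB F N j γ εbg ε₀ ε₂₉ B₃ B₃' a₀ a₁ Efl logz).s2.cR * (theta13OfThm1CCMWZB F N j γ εbg ε₀ ε₂₉ B₃ B₃' a₀ a₁ Efl logz).ν.A₀ :=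
  mul_A0_nonneg_thm1CCM (F := F) (N := N) (j := j) (ε₀ := ε₀) (ε₂₉ := ε₂₉) hB hB' ha₀ ha₁

/-- The «C₀ sufficiently large» inequality of (2.34) at `θ₁₅ᶜᶜᴹᵂᶻᴮ(j; γ; εbg)`: `B₃·cR·A₀ᶜᶜ¹ ≤ (1 − β)·C₀` (window-blind). [cite: Balaban1988Convergent, (2.28) p.259, (2.34) p.261] -/
theorem mul_A0_le_C₀_thm1CCMWZB (hB : 0 ≤ B₃) (hB' : 0 ≤ B₃') (ha₀ : 0 ≤ a₀) (ha₁ : 0 ≤ a₁) :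
    B₃ * (theta13OfThm1CCMWZB F N j γ εbg ε₀ ε₂₉ B₃ B₃' a₀ a₁ Efl logz).s2.cR * (theta13OfThm1CCMWZB F N j γ εbg ε₀ ε₂₉ B₃ B₃' a₀ a₁ Efl logz).ν.A₀ ≤
      (1 - (theta13OfThm1CCMWZB F N j γ εbg ε₀ ε₂₉ B₃ B₃' a₀ a₁ Efl logz).s2.βc) * (lfOfRecord₁₂ F N (theta13OfThm1CCMWZB F N j γ εbg ε₀ ε₂₉ B₃ B₃' a₀ a₁ Efl logz).toStage12Params).C₀ := by
  rw [theta13OfThm1CCMWZB_cR, mul_one, theta13OfThm1CCMWZB_A₀, theta13OfThm1CCMWZB_βc, lfOfRecord₁₂_theta13OfThm1CCMWZB]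
  have h := mul_A0OfThm1CC1_le (L := F.L) hB hB' ha₀ ha₁
  norm_num [lfConstsOfFamily, lfConstsOfRecord₁₂]
  linarith

/-- **(hBα) AT `θ₁₅ᶜᶜᴹᵂᶻᴮ(j; γ; εbg)`** (`bg_numerics_of_letters`: `p₀ = 1 ≤ q₀ = 2`, `B₃·A₀ᶜᶜ¹ ≤ ¾·C₀`, `g_m² ≤ e⁻¹`). [cite: Balaban1988Convergent, (2.4) p.255, (2.28) p.259, (2.34) p.261] -/
theorem hBα_theta13OfThm1CCMWZB (hγ : γ ≤ 1 / 2) (hB : 0 ≤ B₃) (hB' : 0 ≤ B₃') (ha₀ : 0 ≤ a₀) (ha₁ : 0 ≤ a₁) :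
     ∀ (p : B12.RunParams) (n : ℕ), n ≤ p.K → Step.InInterval (theta13OfThm1CCMWZB F N j γ εbg ε₀ ε₂₉ B₃ B₃' a₀ a₁ Efl logz).γ n (gOfRecord₁₃ F N (theta13OfThm1CCMWZB F N j γ εbg ε₀ ε₂₉ B₃ B₃' a₀ a₁ Efl logz) p) → ∀ m, 1 ≤ m → m ≤ n →
      B₃ * ((theta13OfThm1CCMWZB F N j γ εbg ε₀ ε₂₉ B₃ B₃' a₀ a₁ Efl logz).s2.cR * epsOfRecord (theta13OfThm1CCMWZB F N j γ εbg ε₀ ε₂₉ B₃ B₃' a₀ a₁ Efl logz).ν (gOfRecord₁₃ F N (theta13OfThm1CCMWZB F N j γ εbg ε₀ ε₂₉ B₃ B₃' a₀ a₁ Efl logz) p) m) ≤ (1 - (theta13OfThm1CCMWZB F N j γ εbg ε₀ ε₂₉ B₃ B₃' a₀ a₁ Efl logz).s2.βc) * (lfOfRecord₁₂ F N (theta13OfThm1CCMWZB F N j γ εbg ε₀ ε₂₉ B₃ B₃' a₀ a₁ Efl logz).toStage12Params).alpha0 (gOfRecord₁₃ F N (theta13OfThm1CCMWZB F N j γ εbg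 ε₀ ε₂₉ B₃ B₃' a₀ a₁ Efl logz) p m) :=
  fun p n _ hw =>
    (theta13OfThm1CCMWZB F N j γ εbg ε₀ ε₂₉ B₃ B₃' a₀ a₁ Efl logz).bg_numerics_of_letters hpq_theta13OfThm1CCMWZB
      (mul_A0_nonneg_thm1CCMWZB hB hB' ha₀ ha₁) (mul_A0_le_C₀_thm1CCMWZB hB hB' ha₀ ha₁) p n (hg_theta13OfThm1CCMWZB hγ p n ‹_› hw)

/-- **(C1) NESTED GRIDS AT `θ₁₅ᶜᶜᴹᵂᶻᴮ(j; γ; εbg)`**: `R_m = L·t_m` along every windowed run (`L ≥ 2`, `r = 1`, `log g_m⁻² > 1` in `]0, γ] ⊆ ]0, ½]`). [cite: Balaban1988Convergent, (2.5) p.255, p.257] -/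
theorem hC1_theta13OfThm1CCMWZB (hγ : γ ≤ 1 / 2) :
     ∀ (p : B12.RunParams) (n : ℕ), n ≤ p.K → Step.InInterval (theta13OfThm1CCMWZB F N j γ εbg ε₀ ε₂₉ B₃ B₃' a₀ a₁ Efl logz).γ n (gOfRecord₁₃ F N (theta13OfThm1CCMWZB F N j γ εbg ε₀ ε₂₉ B₃ B₃' a₀ a₁ Efl logz) p) → ∀ m, 1 ≤ m → m ≤ n →
      ∃ t : ℕ, 0 < t ∧ RkOfRecord (F.P p.K).L (theta13OfThm1CCMWZB F N j γ εbg ε₀ ε₂₉ B₃ B₃' a₀ a₁ Efl logz).ν.r (gOfRecord₁₃ F N (theta13OfThm1CCMWZB F N j γ εbg ε₀ ε₂₉ B₃ B₃' a₀ a₁ Efl logz) p m) = (F.P p.K).L * t := by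
  intro p n _ hw m _ hm
  have hL : 2 ≤ (F.P p.K).L := by show 2 ≤ F.L; have := F.hL11; omega
  exact exists_RkOfRecord_eq_mul hL (le_of_eq (theta13OfThm1CCMWZB_r F N j γ εbg ε₀ ε₂₉ B₃ B₃' a₀ a₁ Efl logz).symm)
    (one_lt_log_inv_sq_of_le_half (hw m hm).1 ((hw m hm).2.trans ((theta13OfThm1CCMWZB_γ F N j γ εbg ε₀ ε₂₉ B₃ B₃' a₀ a₁ Efl logz).trans_le hγ)))

/-- **(hcomp) AT `θ₁₅ᶜᶜᴹᵂᶻᴮ(j; γ; εbg)` from the MONOTONICITY of the windowed history** (`cR·ε_m ≤ 2·cR·ε_{m+1}`; `p₀ = 1`, `A₀ ≥ 0`, `g_{m+1} ≤ γ ≤ ½`).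
[cite: Balaban1988Convergent, (2.4) p.255, (2.7)–(2.8) pp.255–256; Balaban1987RG1, Thm 1 p.259] -/
theorem hcomp_theta13OfThm1CCMWZB_of_monotone (hγ : γ ≤ 1 / 2) (hB : 0 ≤ B₃) (hB' : 0 ≤ B₃') (ha₀ : 0 ≤ a₀) (ha₁ : 0 ≤ a₁)
    (hmono : ∀ (p : B12.RunParams) (n : ℕ), n ≤ p.K → Step.InInterval (theta13OfThm1CCMWZB F N j γ εbg ε₀ ε₂₉ B₃ B₃' a₀ a₁ Efl logz).γ n (gOfRecord₁₃ F N (theta13OfThm1CCMWZB F N j γ εbg ε₀ ε₂₉ B₃ B₃' a₀ a₁ Efl logz) p) → ∀ m, m < n →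
      gOfRecord₁₃ F N (theta13OfThm1CCMWZB F N j γ εbg ε₀ ε₂₉ B₃ B₃' a₀ a₁ Efl logz) p m ≤ gOfRecord₁₃ F N (theta13OfThm1CCMWZB F N j γ εbg ε₀ ε₂₉ B₃ B₃' a₀ a₁ Efl logz) p (m + 1)) :
     ∀ (p : B12.RunParams) (n : ℕ), n ≤ p.K → Step.InInterval (theta13OfThm1CCMWZB F N j γ εbg ε₀ ε₂₉ B₃ B₃' a₀ a₁ Efl logz).γ n (gOfRecord₁₃ F N (theta13OfThm1CCMWZB F N j γ εbg ε₀ ε₂₉ B₃ B₃' a₀ a₁ Efl logz) p) → ∀ m, m < n →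
      (theta13OfThm1CCMWZB F N j γ εbg ε₀ ε₂₉ B₃ B₃' a₀ a₁ Efl logz).s2.cR * epsOfRecord (theta13OfThm1CCMWZB F N j γ εbg ε₀ ε₂₉ B₃ B₃' a₀ a₁ Efl logz).ν (gOfRecord₁₃ F N (theta13OfThm1CCMWZB F N j γ εbg ε₀ ε₂₉ B₃ B₃' a₀ a₁ Efl logz) p) m ≤ 2 * ((theta13OfThm1CCMWZB F N j γ εbg ε₀ ε₂₉ B₃ B₃' a₀ a₁ Efl logz).s2.cR * epsOfRecord (theta13OfThm1CCMWZB F N j γ εbg ε₀ ε₂₉ B₃ B₃' a₀ a₁ Efl logz).ν (gOfRecord₁₃ F N (theta13OfThm1CCMWZB F N j γ εbg ε₀ ε₂₉ B₃ B₃' a₀ a₁ Efl logz) p) (m + 1)) := by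
  intro p n hn hw m hm
  rw [theta13OfThm1CCMWZB_cR, one_mul, one_mul]
  have hγ' := theta13OfThm1CCMWZB_γ F N j γ εbg ε₀ ε₂₉ B₃ B₃' a₀ a₁ Efl logz
  have h0 : 0 < gOfRecord₁₃ F N (theta13OfThm1CCMWZB F N j γ εbg ε₀ ε₂₉ B₃ B₃' a₀ a₁ Efl logz) p m := (hw m hm.le).1
  have hhalf : gOfRecord₁₃ F N (theta13OfThm1CCMWZB F N j γ εbg ε₀ ε₂₉ B₃ B₃' a₀ a₁ Efl logz) p (m + 1) ≤ 1 / 2 := ((hw (m + 1) hm).2.trans hγ'.le).trans hγ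
  exact epsOfRecord_le_two_mul_of_le _ (theta13OfThm1CCMWZB_p₀ F N j γ εbg ε₀ ε₂₉ B₃ B₃' a₀ a₁ Efl logz)
    (by rw [theta13OfThm1CCMWZB_A₀]; exact A0OfThm1CC1_nonneg hB hB' ha₀ ha₁) h0 (hmono p n hn hw m hm) hhalf

/-- `0 ≤ B₃′·cR·A₀` at `θ₁₅ᶜᶜᴹᵂᶻᴮ(j; γ; εbg)` (window-blind). [cite: Balaban1988Convergent, (2.28) p.259 (bookkeeping)] -/
theorem gauge_mul_A0_nonneg_thm1CCMWZB (hB : 0 ≤ B₃) (hB' : 0 ≤ B₃') (ha₀ : 0 ≤ a₀) (ha₁ : 0 ≤ a₁) :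
    0 ≤ B₃' * (theta13OfThm1CCMWZB F N j γ εbg ε₀ ε₂₉ B₃ B₃' a₀ a₁ Efl logz).s2.cR * (theta13OfThm1CCMWZB F N j γ εbg ε₀ ε₂₉ B₃ B₃' a₀ a₁ Efl logz).ν.A₀ :=
  gauge_mul_A0_nonneg_thm1CCM (F := F) (N := N) (j := j) (ε₀ := ε₀) (ε₂₉ := ε₂₉) hB hB' ha₀ ha₁

/-- **«C₀ sufficiently large» FOR THE I-FAMILY GAUGES at `θ₁₅ᶜᶜᴹᵂᶻᴮ(j; γ; εbg)`**: `B₃′·cR·A₀ ≤ cB·C₀` (window-blind). [cite: Balaban1987RG1, (1.12) p.262; Balaban1988Convergent, (2.28) p.259] -/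
theorem gauge_mul_A0_le_cB_C₀_thm1CCMWZB (hB : 0 ≤ B₃) (hB' : 0 ≤ B₃') (ha₀ : 0 ≤ a₀) (ha₁ : 0 ≤ a₁) :
    B₃' * (theta13OfThm1CCMWZB F N j γ εbg ε₀ ε₂₉ B₃ B₃' a₀ a₁ Efl logz).s2.cR * (theta13OfThm1CCMWZB F N j γ εbg ε₀ ε₂₉ B₃ B₃' a₀ a₁ Efl logz).ν.A₀ ≤ (theta13OfThm1CCMWZB F N j γ εbg ε₀ ε₂₉ B₃ B₃' a₀ a₁ Efl logz).s2.cB * (lfOfRecord₁₂ F N (theta13OfThm1CCMWZB F N j γ εbg ε₀ ε₂₉ B₃ B₃' a₀ a₁ Efl logz).toStage12Params).C₀ := by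
  rw [theta13OfThm1CCMWZB_cR, mul_one, theta13OfThm1CCMWZB_A₀, theta13OfThm1CCMWZB_cB, lfOfRecord₁₂_theta13OfThm1CCMWZB]
  have h1 : (1 : ℝ) ≤ F.L := by exact_mod_cast F.hL.2.le
  have h := gauge_mul_A0OfThm1CC1_le (L := F.L) F.hL.2.le hB hB' ha₀ ha₁
  norm_num [lfConstsOfFamily, lfConstsOfRecord₁₂]
  nlinarith

/-- **«C₀ sufficiently large» FOR THE MS-FAMILY GAUGES at `θ₁₅ᶜᶜᴹᵂᶻᴮ(j; γ; εbg)`**: `B₃′·cR·A₀ ≤ B·C·M_r·C₀` (window-blind). [cite: Balaban1988Convergent, (2.38) p.261, (2.28) p.259] -/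
theorem gauge_mul_A0_le_BCM_C₀_thm1CCMWZB (hB : 0 ≤ B₃) (hB' : 0 ≤ B₃') (ha₀ : 0 ≤ a₀) (ha₁ : 0 ≤ a₁) :
    B₃' * (theta13OfThm1CCMWZB F N j γ εbg ε₀ ε₂₉ B₃ B₃' a₀ a₁ Efl logz).s2.cR * (theta13OfThm1CCMWZB F N j γ εbg ε₀ ε₂₉ B₃ B₃' a₀ a₁ Efl logz).ν.A₀ ≤ (theta13OfThm1CCMWZB F N j γ εbg ε₀ ε₂₉ B₃ B₃' a₀ a₁ Efl logz).s2.B * (theta13OfThm1CCMWZB F N j γ εbg ε₀ ε₂₉ B₃ B₃' a₀ a₁ Efl logz).s2.C * (theta13OfThm1CCMWZB F N j γ εbg ε₀ ε₂₉ B₃ B₃' a₀ a₁ Efl logz).s2.Mr * (lfOfRecord₁₂ F N (theta13OfThm1CCMWZB F N j γ εbg ε₀ ε₂₉ B₃ B₃' a₀ a₁ Efl logz).toStage12Params).C₀ := by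
  rw [theta13OfThm1CCMWZB_cR, mul_one, theta13OfThm1CCMWZB_A₀, theta13OfThm1CCMWZB_B, theta13OfThm1CCMWZB_C, theta13OfThm1CCMWZB_Mr, lfOfRecord₁₂_theta13OfThm1CCMWZB]
  have h := gauge_mul_A0OfThm1CC1_le (L := F.L) F.hL.2.le hB hB' ha₀ ha₁
  norm_num [lfConstsOfFamily, lfConstsOfRecord₁₂]
  linarith

/-- **★ THE I-FAMILY RADIUS LETTER `htI` ALONG EVERY WINDOWED RUN AT `θ₁₅ᶜᶜᴹᵂᶻᴮ(j; γ; εbg)`**: `B₃′·(cR·ε_m) ≤ cB·α₀(g_m)`, `1 ≤ m ≤ n` (FILE 14 `gaugeLetter_of_numerics`).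
[cite: Balaban1987RG1, (1.12) p.262; Balaban1988Convergent, (2.4) p.255, (2.28) p.259] -/
theorem htI_theta13OfThm1CCMWZB (hγ : γ ≤ 1 / 2) (hB : 0 ≤ B₃) (hB' : 0 ≤ B₃') (ha₀ : 0 ≤ a₀) (ha₁ : 0 ≤ a₁) :
    ∀ (p : B12.RunParams) (n : ℕ), n ≤ p.K → Step.InInterval (theta13OfThm1CCMWZB F N j γ εbg ε₀ ε₂₉ B₃ B₃' a₀ a₁ Efl logz).γ n (gOfRecord₁₃ F N (theta13OfThm1CCMWZB F N j γ εbg ε₀ ε₂₉ B₃ B₃' a₀ a₁ Efl logz) p) → ∀ m, 1 ≤ m → m ≤ n →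
      B₃' * ((theta13OfThm1CCMWZB F N j γ εbg ε₀ ε₂₉ B₃ B₃' a₀ a₁ Efl logz).s2.cR * epsOfRecord (theta13OfThm1CCMWZB F N j γ εbg ε₀ ε₂₉ B₃ B₃' a₀ a₁ Efl logz).ν (gOfRecord₁₃ F N (theta13OfThm1CCMWZB F N j γ εbg ε₀ ε₂₉ B₃ B₃' a₀ a₁ Efl logz) p) m) ≤
        (theta13OfThm1CCMWZB F N j γ εbg ε₀ ε₂₉ B₃ B₃' a₀ a₁ Efl logz).s2.cB * (lfOfRecord₁₂ F N (theta13OfThm1CCMWZB F N j γ εbg ε₀ ε₂₉ B₃ B₃' a₀ a₁ Efl logz).toStage12Params).alpha0 (gOfRecord₁₃ F N (theta13OfThm1CCMWZB F N j γ εbg ε₀ ε₂₉ B₃ B₃' a₀ a₁ Efl logz) p m) :=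
  fun p n hn hw => gaugeLetter_of_numerics (lfOfRecord₁₂ F N (theta13OfThm1CCMWZB F N j γ εbg ε₀ ε₂₉ B₃ B₃' a₀ a₁ Efl logz).toStage12Params) (theta13OfThm1CCMWZB F N j γ εbg ε₀ ε₂₉ B₃ B₃' a₀ a₁ Efl logz).ν
    (fun m _ hm => hg_theta13OfThm1CCMWZB hγ p n hn hw m hm) hpq_theta13OfThm1CCMWZB (gauge_mul_A0_nonneg_thm1CCMWZB hB hB' ha₀ ha₁) (gauge_mul_A0_le_cB_C₀_thm1CCMWZB hB hB' ha₀ ha₁)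

/-- **★ THE MS-FAMILY RADIUS LETTER `htMS` ALONG EVERY WINDOWED RUN AT `θ₁₅ᶜᶜᴹᵂᶻᴮ(j; γ; εbg)`**: `B₃′·(cR·ε_m) ≤ B·C·M_r·α₀(g_m)`, `1 ≤ m ≤ n`. [cite: Balaban1988Convergent, (2.38) p.261, (2.4) p.255, (2.28) p.259] -/
theorem htMS_theta13OfThm1CCMWZB (hγ : γ ≤ 1 / 2) (hB : 0 ≤ B₃) (hB' : 0 ≤ B₃') (ha₀ : 0 ≤ a₀) (ha₁ : 0 ≤ a₁) :
    ∀ (p : B12.RunParams) (n : ℕ), n ≤ p.K → Step.InInterval (theta13OfThm1CCMWZB F N j γ εbg ε₀ ε₂₉ B₃ B₃' a₀ a₁ Efl logz).γ n (gOfRecord₁₃ F N (theta13OfThm1CCMWZB F N j γ εbg ε₀ ε₂₉ B₃ B₃' a₀ a₁ Efl logz) p) → ∀ m, 1 ≤ m → m ≤ n →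
      B₃' * ((theta13OfThm1CCMWZB F N j γ εbg ε₀ ε₂₉ B₃ B₃' a₀ a₁ Efl logz).s2.cR * epsOfRecord (theta13OfThm1CCMWZB F N j γ εbg ε₀ ε₂₉ B₃ B₃' a₀ a₁ Efl logz).ν (gOfRecord₁₃ F N (theta13OfThm1CCMWZB F N j γ εbg ε₀ ε₂₉ B₃ B₃' a₀ a₁ Efl logz) p) m) ≤
        (theta13OfThm1CCMWZB F N j γ εbg ε₀ ε₂₉ B₃ B₃' a₀ a₁ Efl logz).s2.B * (theta13OfThm1CCMWZB F N j γ εbg ε₀ ε₂₉ B₃ B₃' a₀ a₁ Efl logz).s2.C * (theta13OfThm1CCMWZB F N j γ εbg ε₀ ε₂₉ B₃ B₃' a₀ a₁ Efl logz).s2.Mr * (lfOfRecord₁₂ F N (theta13OfThm1CCMWZB F N j γ εbg ε₀ ε₂₉ B₃ B₃' a₀ a₁ Efl logz).toStage12Params).alpha0 (gOfRecord₁₃ F N (theta13OfThm1CCMWZB F N j γ εbg ε₀ ε₂₉ B₃ B₃' a₀ a₁ Efl logz) p m) :=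
  fun p n hn hw => gaugeLetter_of_numerics (lfOfRecord₁₂ F N (theta13OfThm1CCMWZB F N j γ εbg ε₀ ε₂₉ B₃ B₃' a₀ a₁ Efl logz).toStage12Params) (theta13OfThm1CCMWZB F N j γ εbg ε₀ ε₂₉ B₃ B₃' a₀ a₁ Efl logz).ν
    (fun m _ hm => hg_theta13OfThm1CCMWZB hγ p n hn hw m hm) hpq_theta13OfThm1CCMWZB (gauge_mul_A0_nonneg_thm1CCMWZB hB hB' ha₀ ha₁) (gauge_mul_A0_le_BCM_C₀_thm1CCMWZB hB hB' ha₀ ha₁)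

end Faces

/-! ## §4. The pins, the collar letter and the non-wrapping letter at `θ₁₅ᶜᶜᴹᵂᶻᴮ(j; γ; εbg)` — window-blind (A2's theorems re-read; `τ9.M = ν.M₁ = L^j` by `rfl` on both members) -/

section Pins

variable (F : T4Family) (N : ℕ) [NeZero N] (j : ℕ) (γ εbg ε₀ ε₂₉ B₃ B₃' a₀ a₁ : ℝ) (Efl logz : B12.RunParams → ℕ → ℝ)

/-- `0 < θ₁₅ᶜᶜᴹᵂᶻᴮ(j; γ; εbg).τ9.M`. [cite: Balaban1989LargeFieldI, (2.1) p.182 (bookkeeping)] -/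
theorem τ9_M_pos_theta13OfThm1CCMWZB : 0 < (theta13OfThm1CCMWZB F N j γ εbg ε₀ ε₂₉ B₃ B₃' a₀ a₁ Efl logz).τ9.M := τ9_M_pos_theta13OfThm1CCM F N j ε₀ ε₂₉ B₃ B₃' a₀ a₁

/-- `0 < θ₁₅ᶜᶜᴹᵂᶻᴮ(j; γ; εbg).ν.M₁` — the binder `0 < ν.M₁` of the step facts. [cite: Balaban1985RegularSpaces, (1.3)–(1.6) p.77 (bookkeeping)] -/
theorem M₁_pos_theta13OfThm1CCMWZB : 0 < (theta13OfThm1CCMWZB F N j γ εbg ε₀ ε₂₉ B₃ B₃' a₀ a₁ Efl logz).ν.M₁ := M₁_pos_theta13OfThm1CCM F N j ε₀ ε₂₉ B₃ B₃' a₀ a₁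

/-- **THE PIN `hM`**: the cube letter is a power of `L` (`⟨j, rfl⟩`). [cite: Balaban1988Convergent, (2.18) p.257, p.245 (bookkeeping)] -/
theorem hM_theta13OfThm1CCMWZB : ∃ a : ℕ, (theta13OfThm1CCMWZB F N j γ εbg ε₀ ε₂₉ B₃ B₃' a₀ a₁ Efl logz).τ9.M = F.L ^ a := ⟨j, rfl⟩

/-- **THE PIN `hM₁`**: `M₁ ∣ M` (`L^j ∣ L^j`). [cite: Balaban1988Convergent, (2.13) p.256, (2.18) p.257 (bookkeeping)] -/
theorem hM₁_theta13OfThm1CCMWZB : (theta13OfThm1CCMWZB F N j γ εbg ε₀ ε₂₉ B₃ B₃' a₀ a₁ Efl logz).ν.M₁ ∣ (theta13OfThm1CCMWZB F N j γ εbg ε₀ ε₂₉ B₃ B₃' a₀ a₁ Efl logz).τ9.M := dvd_refl _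

variable {j} in
/-- **★ THE COLLAR LETTER OF THE R-ROAD AT `θ₁₅ᶜᶜᴹᵂᶻᴮ(j; γ; εbg)`**: `(11·4 + 3·L)·L ≤ ν.M₁` for every `j ≥ 3` (A2's, window-blind). [cite: Balaban1985RegularSpaces, Prop. 6 p.99, (1.130) p.99, (1.3)–(1.6) p.77; Balaban1985Variational, (144) p.300 (bookkeeping)] -/
theorem collar_le_M₁_theta13OfThm1CCMWZB (hj : 3 ≤ j) : (11 * 4 + 3 * F.L) * F.L ≤ (theta13OfThm1CCMWZB F N j γ εbg ε₀ ε₂₉ B₃ B₃' a₀ a₁ Efl logz).ν.M₁ :=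
  collar_le_M₁_theta13OfThm1CCM F N ε₀ ε₂₉ B₃ B₃' a₀ a₁ hj

variable {j} in
/-- The collar letter in the `Setup.Params` letters of every torus of the family. [cite: Balaban1985RegularSpaces, Prop. 6 p.99 (bookkeeping)] -/
theorem collar_le_M₁_theta13OfThm1CCMWZB' (hj : 3 ≤ j) (K : ℕ) :
    (11 * (F.P K).d + 3 * (F.P K).L) * (F.P K).L ≤ (theta13OfThm1CCMWZB F N j γ εbg ε₀ ε₂₉ B₃ B₃' a₀ a₁ Efl logz).ν.M₁ :=
  collar_le_M₁_theta13OfThm1CCMWZB F N γ εbg ε₀ ε₂₉ B₃ B₃' a₀ a₁ Efl logz hj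

variable {j} in
/-- **★ NO WRAPPING AT `θ₁₅ᶜᶜᴹᵂᶻᴮ(j; γ; εbg)` UNDER `j + 1 ≤ F.m`** (A2's, window-blind). [cite: Balaban1987RG1, (0.1) p.251; Balaban1988Convergent, p.257 (bookkeeping)] -/
theorem hsN_theta13OfThm1CCMWZB (hjm : j + 1 ≤ F.m) :
     ∀ (p : B12.RunParams) (n : ℕ), n ≤ p.K → ∀ n', 1 ≤ n' → n' ≤ n + 1 →
      ((B14.Eq213MaximalDomains.side (F.P p.K).L (theta13OfThm1CCMWZB F N j γ εbg ε₀ ε₂₉ B₃ B₃' a₀ a₁ Efl logz).τ9.M n' : ℕ) : ℤ) < (F.P p.K).sitesPerDir 0 :=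
  hsN_theta13OfThm1CCM F N ε₀ ε₂₉ B₃ B₃' a₀ a₁ hjm

variable {j} in
/-- **THE CERTIFICATE OF (δ) AT `θ₁₅ᶜᶜᴹᵂᶻᴮ(j; γ; εbg)`** (window-blind): if `F.m ≤ j` the top [I]-cube wraps on every run. [cite: Balaban1987RG1, (0.1) p.251; Balaban1988Convergent, p.257 (bookkeeping certificate)] -/
theorem exists_wrap_theta13OfThm1CCMWZB_of_le (hmj : F.m ≤ j) (p : B12.RunParams) :
    ∃ n n', n ≤ p.K ∧ 1 ≤ n' ∧ n' ≤ n + 1 ∧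
      ¬ ((B14.Eq213MaximalDomains.side (F.P p.K).L (theta13OfThm1CCMWZB F N j γ εbg ε₀ ε₂₉ B₃ B₃' a₀ a₁ Efl logz).τ9.M n' : ℕ) : ℤ) < (F.P p.K).sitesPerDir 0 :=
  exists_wrap_theta13OfThm1CCM_of_le F N ε₀ ε₂₉ B₃ B₃' a₀ a₁ hmj p

variable {j} in
/-- … so the universally quantified non-wrapping binder fails outright when `F.m ≤ j`. [cite: Balaban1987RG1, (0.1) p.251; Balaban1988Convergent, p.257 (bookkeeping certificate)] -/
theorem not_hsN_theta13OfThm1CCMWZB_of_le (hmj : F.m ≤ j) (p : B12.RunParams) :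
    ¬ ∀ n, n ≤ p.K → ∀ n', 1 ≤ n' → n' ≤ n + 1 →
      ((B14.Eq213MaximalDomains.side (F.P p.K).L (theta13OfThm1CCMWZB F N j γ εbg ε₀ ε₂₉ B₃ B₃' a₀ a₁ Efl logz).τ9.M n' : ℕ) : ℤ) < (F.P p.K).sitesPerDir 0 :=
  not_hsN_theta13OfThm1CCM_of_le F N ε₀ ε₂₉ B₃ B₃' a₀ a₁ hmj p

/-- **THE NON-WRAPPING BINDER AT `θ₁₅ᶜᶜᴹᵂᶻᴮ(j; γ; εbg)` IS EQUIVALENT TO `j + 1 ≤ F.m`** ((δ) is window-blind). [cite: Balaban1987RG1, (0.1) p.251; Balaban1988Convergent, p.257 (bookkeeping certificate)] -/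
theorem hsN_theta13OfThm1CCMWZB_iff (p : B12.RunParams) :
    (∀ n, n ≤ p.K → ∀ n', 1 ≤ n' → n' ≤ n + 1 →
      ((B14.Eq213MaximalDomains.side (F.P p.K).L (theta13OfThm1CCMWZB F N j γ εbg ε₀ ε₂₉ B₃ B₃' a₀ a₁ Efl logz).τ9.M n' : ℕ) : ℤ) < (F.P p.K).sitesPerDir 0) ↔ j + 1 ≤ F.m :=
  hsN_theta13OfThm1CCM_iff F N j ε₀ ε₂₉ B₃ B₃' a₀ a₁ p

end Pins

/-! ## §5. ★★ THE β TRANSFER: on the box `]0, γ]`, `γ ≤ ½`, the β-functions of record of `θ₁₅ᶜᶜᴹᵂᶻᴮ(j; γ; εbg)` and of the half-window member `θ₁₅ᶜᶜᴹᵂᶻᴮ(j; ½; εbg)` coincide -/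

section Transfer

variable {F : T4Family} {N : ℕ} [NeZero N] {j : ℕ} {γ εbg ε₀ ε₂₉ B₃ B₃' a₀ a₁ : ℝ} {Efl logz : B12.RunParams → ℕ → ℝ}

/-- A history in `]0, γ]^{k+1}` is in `]0, γ′]^{k+1}` for `γ ≤ γ′`. [folklore] -/
private theorem mem_box_of_le {γ γ' : ℝ} (h : γ ≤ γ') {k : ℕ} {v : Fin (k + 1) → ℝ} (hv : v ∈ Box γ k) : v ∈ Box γ' k :=
  FlowStep.mem_box.mpr fun i => ⟨(FlowStep.mem_box.mp hv i).1, (FlowStep.mem_box.mp hv i).2.trans h⟩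

/-- **★★ THE β TRANSFER**: for `γ ≤ ½` and every history `v ∈ ]0, γ]^{k+1}`, `β₁₃(θ₁₅ᶜᶜᴹᵂᶻᴮ(j; γ; εbg)) k v = β₁₃(θ₁₅ᶜᶜᴹ(j)) k v` — both witnesses carry the same Stage-7 numerics, (2.9)
threshold, background radius, chart, basis and base histories, so [I] (1.20)–(1.22) on the merged term (1.6) give ONE function `β_merged`, and both box conventions read it on
`]0, γ] ⊆ ]0, ½]` (`betaOfMerged_of_mem`). [cite: Balaban1987RG1, (1.20)–(1.22) p.264, (1.6) p.261, (2.12)–(2.14) p.268] -/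
theorem betaOfRecord₁₃_theta13OfThm1CCMWZB_eq_of_mem (hγ : γ ≤ 1 / 2) {k : ℕ} {v : Fin (k + 1) → ℝ} (hv : v ∈ Box γ k) :
    betaOfRecord₁₃ F N (theta13OfThm1CCMWZB F N j γ εbg ε₀ ε₂₉ B₃ B₃' a₀ a₁ Efl logz) k v = betaOfRecord₁₃ F N (theta13OfThm1CCMWZB F N j (1 / 2) εbg ε₀ ε₂₉ B₃ B₃' a₀ a₁ Efl logz) k v := by
  have hv' : v ∈ Box (1 / 2 : ℝ) k := mem_box_of_le hγ hv
  show betaOfMerged _ _ γ k v = betaOfMerged _ _ (1 / 2 : ℝ) k v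
  rw [betaOfMerged_of_mem _ _ _ hv, betaOfMerged_of_mem _ _ _ hv']
  rfl

/-- **A LOWER β-BOUND OF THE HALF-WINDOW MEMBER ON `]0, γ]` IS ONE OF THE WINDOW EDITION** (`γ ≤ ½`). [cite: Balaban1987RG1, (1.20)–(1.22) p.264, §1 p.264; Balaban1989LargeFieldII, (1.4) p.357] -/
theorem betaLowerH_theta13OfThm1CCMWZB_of_half (hγ : γ ≤ 1 / 2) {b : ℝ} (h : BetaLowerH b γ (betaOfRecord₁₃ F N (theta13OfThm1CCMWZB F N j (1 / 2) εbg ε₀ ε₂₉ B₃ B₃' a₀ a₁ Efl logz))) :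
    BetaLowerH b γ (betaOfRecord₁₃ F N (theta13OfThm1CCMWZB F N j γ εbg ε₀ ε₂₉ B₃ B₃' a₀ a₁ Efl logz)) :=
  fun k v hv => by rw [betaOfRecord₁₃_theta13OfThm1CCMWZB_eq_of_mem hγ hv]; exact h k v hv

/-- **AN UPPER β-BOUND OF THE HALF-WINDOW MEMBER ON `]0, γ]` IS ONE OF THE WINDOW EDITION** (`γ ≤ ½`). [cite: Balaban1987RG1, (1.20)–(1.22) p.264, §1 p.264 («uniformly bounded»)] -/
theorem betaUpperH_theta13OfThm1CCMWZB_of_half (hγ : γ ≤ 1 / 2) {β' : ℝ} (h : BetaUpperH β' γ (betaOfRecord₁₃ F N (theta13OfThm1CCMWZB F N j (1 / 2) εbg ε₀ ε₂₉ B₃ B₃' a₀ a₁ Efl logz))) :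
    BetaUpperH β' γ (betaOfRecord₁₃ F N (theta13OfThm1CCMWZB F N j γ εbg ε₀ ε₂₉ B₃ B₃' a₀ a₁ Efl logz)) :=
  fun k v hv => by rw [betaOfRecord₁₃_theta13OfThm1CCMWZB_eq_of_mem hγ hv]; exact h k v hv

/-- … and conversely (the transfer is an equality on the box). [cite: Balaban1987RG1, (1.20)–(1.22) p.264 (bookkeeping)] -/
theorem betaLowerH_half_of_theta13OfThm1CCMWZB (hγ : γ ≤ 1 / 2) {b : ℝ} (h : BetaLowerH b γ (betaOfRecord₁₃ F N (theta13OfThm1CCMWZB F N j γ εbg ε₀ ε₂₉ B₃ B₃' a₀ a₁ Efl logz))) :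
    BetaLowerH b γ (betaOfRecord₁₃ F N (theta13OfThm1CCMWZB F N j (1 / 2) εbg ε₀ ε₂₉ B₃ B₃' a₀ a₁ Efl logz)) :=
  fun k v hv => by rw [← betaOfRecord₁₃_theta13OfThm1CCMWZB_eq_of_mem (j := j) (γ := γ) hγ hv]; exact h k v hv

/-- … and conversely for the upper bound. [cite: Balaban1987RG1, (1.20)–(1.22) p.264 (bookkeeping)] -/
theorem betaUpperH_half_of_theta13OfThm1CCMWZB (hγ : γ ≤ 1 / 2) {β' : ℝ} (h : BetaUpperH β' γ (betaOfRecord₁₃ F N (theta13OfThm1CCMWZB F N j γ εbg ε₀ ε₂₉ B₃ B₃' a₀ a₁ Efl logz))) :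
    BetaUpperH β' γ (betaOfRecord₁₃ F N (theta13OfThm1CCMWZB F N j (1 / 2) εbg ε₀ ε₂₉ B₃ B₃' a₀ a₁ Efl logz)) :=
  fun k v hv => by rw [← betaOfRecord₁₃_theta13OfThm1CCMWZB_eq_of_mem (j := j) (γ := γ) hγ hv]; exact h k v hv

end Transfer

/-! ## §6. The two history clauses at `θ₁₅ᶜᶜᴹᵂᶻᴮ(j; γ; εbg)` from the β-box on `]0, γ]` (13e ∕ 14d are θ-generic), and ★ from the β-box of the half-window member on `]0, γ]` -/

section History

variable {F : T4Family} {N : ℕ} [NeZero N] {j : ℕ} {γ εbg ε₀ ε₂₉ B₃ B₃' a₀ a₁ : ℝ} {Efl logz : B12.RunParams → ℕ → ℝ}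

/-- **(hmono) AT `θ₁₅ᶜᶜᴹᵂᶻᴮ(j; γ; εbg)` from `BetaLowerH b γ β₁₃(θ₁₅ᶜᶜᴹᵂᶻᴮ(j; γ; εbg))`, `0 ≤ b`**. [cite: Balaban1987RG1, (0.20) p.256, §1 p.264; Balaban1988Convergent, (2.6) p.255] -/
theorem hmono_theta13OfThm1CCMWZB_of_betaLowerH {b : ℝ} (hb : 0 ≤ b) (hlow : BetaLowerH b γ (betaOfRecord₁₃ F N (theta13OfThm1CCMWZB F N j γ εbg ε₀ ε₂₉ B₃ B₃' a₀ a₁ Efl logz))) :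
    ∀ (p : B12.RunParams) (n : ℕ), n ≤ p.K → Step.InInterval (theta13OfThm1CCMWZB F N j γ εbg ε₀ ε₂₉ B₃ B₃' a₀ a₁ Efl logz).γ n (gOfRecord₁₃ F N (theta13OfThm1CCMWZB F N j γ εbg ε₀ ε₂₉ B₃ B₃' a₀ a₁ Efl logz) p) → ∀ m, m < n →
      gOfRecord₁₃ F N (theta13OfThm1CCMWZB F N j γ εbg ε₀ ε₂₉ B₃ B₃' a₀ a₁ Efl logz) p m ≤ gOfRecord₁₃ F N (theta13OfThm1CCMWZB F N j γ εbg ε₀ ε₂₉ B₃ B₃' a₀ a₁ Efl logz) p (m + 1) :=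
  (theta13OfThm1CCMWZB F N j γ εbg ε₀ ε₂₉ B₃ B₃' a₀ a₁ Efl logz).hmono_of_betaLowerH hb ((theta13OfThm1CCMWZB_γ F N j γ εbg ε₀ ε₂₉ B₃ B₃' a₀ a₁ Efl logz).symm ▸ hlow)

/-- **(hcomp) AT `θ₁₅ᶜᶜᴹᵂᶻᴮ(j; γ; εbg)` FROM THE β-SIGN LEAF** on `]0, γ]`, `γ ≤ ½`. [cite: Balaban1988Convergent, (2.4) p.255, (2.6)–(2.8) pp.255–256; Balaban1987RG1, (0.20) p.256, §1 p.264] -/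
theorem hcomp_theta13OfThm1CCMWZB_of_betaLowerH (hγ : γ ≤ 1 / 2) (hB : 0 ≤ B₃) (hB' : 0 ≤ B₃') (ha₀ : 0 ≤ a₀) (ha₁ : 0 ≤ a₁)
    {b : ℝ} (hb : 0 ≤ b) (hlow : BetaLowerH b γ (betaOfRecord₁₃ F N (theta13OfThm1CCMWZB F N j γ εbg ε₀ ε₂₉ B₃ B₃' a₀ a₁ Efl logz))) :
    ∀ (p : B12.RunParams) (n : ℕ), n ≤ p.K → Step.InInterval (theta13OfThm1CCMWZB F N j γ εbg ε₀ ε₂₉ B₃ B₃' a₀ a₁ Efl logz).γ n (gOfRecord₁₃ F N (theta13OfThm1CCMWZB F N j γ εbg ε₀ ε₂₉ B₃ B₃' a₀ a₁ Efl logz) p) → ∀ m, m < n →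
      (theta13OfThm1CCMWZB F N j γ εbg ε₀ ε₂₉ B₃ B₃' a₀ a₁ Efl logz).s2.cR * epsOfRecord (theta13OfThm1CCMWZB F N j γ εbg ε₀ ε₂₉ B₃ B₃' a₀ a₁ Efl logz).ν (gOfRecord₁₃ F N (theta13OfThm1CCMWZB F N j γ εbg ε₀ ε₂₉ B₃ B₃' a₀ a₁ Efl logz) p) m ≤ 2 * ((theta13OfThm1CCMWZB F N j γ εbg ε₀ ε₂₉ B₃ B₃' a₀ a₁ Efl logz).s2.cR * epsOfRecord (theta13OfThm1CCMWZB F N j γ εbg ε₀ ε₂₉ B₃ B₃' a₀ a₁ Efl logz).ν (gOfRecord₁₃ F N (theta13OfThm1CCMWZB F N j γ εbg ε₀ ε₂₉ B₃ B₃' a₀ a₁ Efl logz) p) (m + 1)) :=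
  hcomp_theta13OfThm1CCMWZB_of_monotone hγ hB hB' ha₀ ha₁ (hmono_theta13OfThm1CCMWZB_of_betaLowerH hb hlow)

/-- **★★ THE REVERSE COMPARABILITY CLAUSE AT `θ₁₅ᶜᶜᴹᵂᶻᴮ(j; γ; εbg)`** (`γ ≤ ½ ≤ 1`, `cR = 1`, `A₀ = A₀ᶜᶜ¹ ≥ 0`) from the β-box on `]0, γ]` with `0 ≤ b` and the 14d letter `β′·γ² ≤ ¾`.
CONDITIONAL on the displayed β-box; nothing of Bałaban asserted. [cite: Balaban1988Convergent, (2.4) p.255, (2.6)–(2.8) pp.255–256; Balaban1987RG1, (0.20) p.256, §1 p.264; Balaban1985Variational, Thm 1 p.279] -/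
theorem hcompRev_theta13OfThm1CCMWZB_of_betaBox (hγ : γ ≤ 1 / 2) (hB : 0 ≤ B₃) (hB' : 0 ≤ B₃') (ha₀ : 0 ≤ a₀) (ha₁ : 0 ≤ a₁)
    {b β' : ℝ} (hb : 0 ≤ b) (hlow : BetaLowerH b γ (betaOfRecord₁₃ F N (theta13OfThm1CCMWZB F N j γ εbg ε₀ ε₂₉ B₃ B₃' a₀ a₁ Efl logz)))
    (hup : BetaUpperH β' γ (betaOfRecord₁₃ F N (theta13OfThm1CCMWZB F N j γ εbg ε₀ ε₂₉ B₃ B₃' a₀ a₁ Efl logz))) (hletter : β' * γ ^ 2 ≤ 3 / 4) :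
    ∀ (p : B12.RunParams) (n : ℕ), n ≤ p.K → Step.InInterval (theta13OfThm1CCMWZB F N j γ εbg ε₀ ε₂₉ B₃ B₃' a₀ a₁ Efl logz).γ n (gOfRecord₁₃ F N (theta13OfThm1CCMWZB F N j γ εbg ε₀ ε₂₉ B₃ B₃' a₀ a₁ Efl logz) p) → ∀ m, m < n →
      (theta13OfThm1CCMWZB F N j γ εbg ε₀ ε₂₉ B₃ B₃' a₀ a₁ Efl logz).s2.cR * epsOfRecord (theta13OfThm1CCMWZB F N j γ εbg ε₀ ε₂₉ B₃ B₃' a₀ a₁ Efl logz).ν (gOfRecord₁₃ F N (theta13OfThm1CCMWZB F N j γ εbg ε₀ ε₂₉ B₃ B₃' a₀ a₁ Efl logz) p) (m + 1) ≤ 2 * ((theta13OfThm1CCMWZB F N j γ εbg ε₀ ε₂₉ B₃ B₃' a₀ a₁ Efl logz).s2.cR * epsOfRecord (theta13OfThm1CCMWZB F N j γ εbg ε₀ ε₂₉ B₃ B₃' a₀ a₁ Efl logz).ν (gOfRecord₁₃ F N (theta13OfThm1CCMWZB F N j γ εbg ε₀ ε₂₉ B₃ B₃' a₀ a₁ Efl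 logz) p) m) :=
  (theta13OfThm1CCMWZB F N j γ εbg ε₀ ε₂₉ B₃ B₃' a₀ a₁ Efl logz).hcompRev_of_betaBox (by rw [theta13OfThm1CCMWZB_A₀]; exact A0OfThm1CC1_nonneg hB hB' ha₀ ha₁)
    (by rw [theta13OfThm1CCMWZB_γ]; linarith) (by rw [theta13OfThm1CCMWZB_cR]; norm_num) hb ((theta13OfThm1CCMWZB_γ F N j γ εbg ε₀ ε₂₉ B₃ B₃' a₀ a₁ Efl logz).symm ▸ hlow)
    ((theta13OfThm1CCMWZB_γ F N j γ εbg ε₀ ε₂₉ B₃ B₃' a₀ a₁ Efl logz).symm ▸ hup) (by rw [theta13OfThm1CCMWZB_γ]; exact hletter)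

/-- **★★ (hmono) AT `θ₁₅ᶜᶜᴹᵂᶻᴮ(j; γ; εbg)` FROM THE β-SIGN OF THE HALF-WINDOW MEMBER ON `]0, γ]`** (§5 transfer, `γ ≤ ½`). [cite: Balaban1987RG1, (0.20) p.256, (1.20)–(1.22) p.264; Balaban1989LargeFieldII, (1.4) p.357] -/
theorem hmono_theta13OfThm1CCMWZB_of_betaLowerH_half (hγ : γ ≤ 1 / 2) {b : ℝ} (hb : 0 ≤ b)
    (hlow : BetaLowerH b γ (betaOfRecord₁₃ F N (theta13OfThm1CCMWZB F N j (1 / 2) εbg ε₀ ε₂₉ B₃ B₃' a₀ a₁ Efl logz))) :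
    ∀ (p : B12.RunParams) (n : ℕ), n ≤ p.K → Step.InInterval (theta13OfThm1CCMWZB F N j γ εbg ε₀ ε₂₉ B₃ B₃' a₀ a₁ Efl logz).γ n (gOfRecord₁₃ F N (theta13OfThm1CCMWZB F N j γ εbg ε₀ ε₂₉ B₃ B₃' a₀ a₁ Efl logz) p) → ∀ m, m < n →
      gOfRecord₁₃ F N (theta13OfThm1CCMWZB F N j γ εbg ε₀ ε₂₉ B₃ B₃' a₀ a₁ Efl logz) p m ≤ gOfRecord₁₃ F N (theta13OfThm1CCMWZB F N j γ εbg ε₀ ε₂₉ B₃ B₃' a₀ a₁ Efl logz) p (m + 1) :=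
  hmono_theta13OfThm1CCMWZB_of_betaLowerH hb (betaLowerH_theta13OfThm1CCMWZB_of_half hγ hlow)

/-- **★★ THE REVERSE COMPARABILITY CLAUSE AT `θ₁₅ᶜᶜᴹᵂᶻᴮ(j; γ; εbg)` FROM THE β-BOX OF THE HALF-WINDOW MEMBER ON `]0, γ]`** (`γ ≤ ½`, `0 ≤ b`, `β′·γ² ≤ ¾`; §5 transfer ∘ 14d).
[cite: Balaban1988Convergent, (2.6)–(2.8) pp.255–256; Balaban1987RG1, (0.20) p.256, (1.20)–(1.22) p.264, §1 p.264] -/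
theorem hcompRev_theta13OfThm1CCMWZB_of_betaBox_half (hγ : γ ≤ 1 / 2) (hB : 0 ≤ B₃) (hB' : 0 ≤ B₃') (ha₀ : 0 ≤ a₀) (ha₁ : 0 ≤ a₁)
    {b β' : ℝ} (hb : 0 ≤ b) (hlow : BetaLowerH b γ (betaOfRecord₁₃ F N (theta13OfThm1CCMWZB F N j (1 / 2) εbg ε₀ ε₂₉ B₃ B₃' a₀ a₁ Efl logz)))
    (hup : BetaUpperH β' γ (betaOfRecord₁₃ F N (theta13OfThm1CCMWZB F N j (1 / 2) εbg ε₀ ε₂₉ B₃ B₃' a₀ a₁ Efl logz))) (hletter : β' * γ ^ 2 ≤ 3 / 4) :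
    ∀ (p : B12.RunParams) (n : ℕ), n ≤ p.K → Step.InInterval (theta13OfThm1CCMWZB F N j γ εbg ε₀ ε₂₉ B₃ B₃' a₀ a₁ Efl logz).γ n (gOfRecord₁₃ F N (theta13OfThm1CCMWZB F N j γ εbg ε₀ ε₂₉ B₃ B₃' a₀ a₁ Efl logz) p) → ∀ m, m < n →
      (theta13OfThm1CCMWZB F N j γ εbg ε₀ ε₂₉ B₃ B₃' a₀ a₁ Efl logz).s2.cR * epsOfRecord (theta13OfThm1CCMWZB F N j γ εbg ε₀ ε₂₉ B₃ B₃' a₀ a₁ Efl logz).ν (gOfRecord₁₃ F N (theta13OfThm1CCMWZB F N j γ εbg ε₀ ε₂₉ B₃ B₃' a₀ a₁ Efl logz) p) (m + 1) ≤ 2 * ((theta13OfThm1CCMWZB F N j γ εbg ε₀ ε₂₉ B₃ B₃' a₀ a₁ Efl logz).s2.cR * epsOfRecord (theta13OfThm1CCMWZB F N j γ εbg ε₀ ε₂₉ B₃ B₃' a₀ a₁ Efl logz).ν (gOfRecord₁₃ F N (theta13OfThm1CCMWZB F N j γ εbg ε₀ ε₂₉ B₃ B₃' a₀ a₁ Efl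 logz) p) m) :=
  hcompRev_theta13OfThm1CCMWZB_of_betaBox hγ hB hB' ha₀ ha₁ hb (betaLowerH_theta13OfThm1CCMWZB_of_half hγ hlow) (betaUpperH_theta13OfThm1CCMWZB_of_half hγ hup) hletter

end History

/-! ## §6′. ★ The SIGN-FREE pair at `θ₁₅ᶜᶜᴹᵂᶻᴮ(j; γ; εbg)` (node O P3 g48 ∕ dag-n21-c `Record13SignFreeComparabilityOfBetaBox` §4ʷ, token-pass; §3 there is θ-generic): (hcomp) ∧ (hcompRev) from a two-sided box `bₗ ≤ β ≤ β′` of ANY sign -/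

section SignFree

variable {F : T4Family} {N : ℕ} [NeZero N] {j : ℕ} {γ εbg ε₀ ε₂₉ B₃ B₃' a₀ a₁ : ℝ} {Efl logz : B12.RunParams → ℕ → ℝ}

/-- **★ʷ (hcomp) ∧ (hcompRev) AT `θ₁₅ᶜᶜᴹᵂᶻᴮ(j; γ; εbg)` FROM THE SIGN-FREE β-BOX OF ITS OWN β-FUNCTIONS ON `]0, γ]`** (`γ ≤ ½`; `bₗ`, `β′` of any sign with `−bₗ·γ² ≤ 3`, `β′·γ² ≤ ¾`; weak signs of the class
constants) — §3 at `θ := θ₁₅ᶜᶜᴹᵂᶻᴮ(j; γ; εbg)`.  The sign-free twin of §6 (node O P3 g48's observation, tree file `Record13SignFreeComparabilityOfBetaBox` §4ʷ, token-pass).  CONDITIONAL on the displayed box.  (node O P3 g48 §4ʷ at Z3.) [cite: Balaban1988Convergent, (2.4) p.255, (2.6)–(2.8) pp.255–256; Balaban1987RG1, (0.20) p.256, §1 p.264] -/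
theorem hcompBoth_theta13OfThm1CCMWZB_of_betaBoxSignFree (hγ : γ ≤ 1 / 2) (hB : 0 ≤ B₃) (hB' : 0 ≤ B₃') (ha₀ : 0 ≤ a₀) (ha₁ : 0 ≤ a₁) {bl β' : ℝ}
    (hlow : BetaLowerH bl γ (betaOfRecord₁₃ F N (theta13OfThm1CCMWZB F N j γ εbg ε₀ ε₂₉ B₃ B₃' a₀ a₁ Efl logz)))
    (hup : BetaUpperH β' γ (betaOfRecord₁₃ F N (theta13OfThm1CCMWZB F N j γ εbg ε₀ ε₂₉ B₃ B₃' a₀ a₁ Efl logz))) (hl : -bl * γ ^ 2 ≤ 3) (hu : β' * γ ^ 2 ≤ 3 / 4) :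
    (∀ (p : B12.RunParams) (n : ℕ), n ≤ p.K → Step.InInterval (theta13OfThm1CCMWZB F N j γ εbg ε₀ ε₂₉ B₃ B₃' a₀ a₁ Efl logz).γ n (gOfRecord₁₃ F N (theta13OfThm1CCMWZB F N j γ εbg ε₀ ε₂₉ B₃ B₃' a₀ a₁ Efl logz) p) → ∀ m, m < n →
      (theta13OfThm1CCMWZB F N j γ εbg ε₀ ε₂₉ B₃ B₃' a₀ a₁ Efl logz).s2.cR * epsOfRecord (theta13OfThm1CCMWZB F N j γ εbg ε₀ ε₂₉ B₃ B₃' a₀ a₁ Efl logz).ν (gOfRecord₁₃ F N (theta13OfThm1CCMWZB F N j γ εbg ε₀ ε₂₉ B₃ B₃' a₀ a₁ Efl logz) p) m ≤ 2 * ((theta13OfThm1CCMWZB F N j γ εbg ε₀ ε₂₉ B₃ B₃' a₀ a₁ Efl logz).s2.cR * epsOfRecord (theta13OfThm1CCMWZB F N j γ εbg ε₀ ε₂₉ B₃ B₃' a₀ a₁ Efl logz).ν (gOfRecord₁₃ F N (theta13OfThm1CCMWZB F N j γ εbg ε₀ ε₂₉ B₃ B₃' a₀ a₁ Efl logz) p)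 (m + 1))) ∧
    (∀ (p : B12.RunParams) (n : ℕ), n ≤ p.K → Step.InInterval (theta13OfThm1CCMWZB F N j γ εbg ε₀ ε₂₉ B₃ B₃' a₀ a₁ Efl logz).γ n (gOfRecord₁₃ F N (theta13OfThm1CCMWZB F N j γ εbg ε₀ ε₂₉ B₃ B₃' a₀ a₁ Efl logz) p) → ∀ m, m < n →
      (theta13OfThm1CCMWZB F N j γ εbg ε₀ ε₂₉ B₃ B₃' a₀ a₁ Efl logz).s2.cR * epsOfRecord (theta13OfThm1CCMWZB F N j γ εbg ε₀ ε₂₉ B₃ B₃' a₀ a₁ Efl logz).ν (gOfRecord₁₃ F N (theta13OfThm1CCMWZB F N j γ εbg ε₀ ε₂₉ B₃ B₃' a₀ a₁ Efl logz) p) (m + 1) ≤ 2 * ((theta13OfThm1CCMWZB F N j γ εbg ε₀ ε₂₉ B₃ B₃' a₀ a₁ Efl logz).s2.cR * epsOfRecord (theta13OfThm1CCMWZB F N j γ εbg ε₀ ε₂₉ B₃ B₃' a₀ a₁ Efl logz).ν (gOfRecord₁₃ F N (theta13OfThm1CCMWZB F N j γ εbg ε₀ ε₂₉ B₃ B₃'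 a₀ a₁ Efl logz) p) m)) := by
  have hγ' := theta13OfThm1CCMWZB_γ F N j γ εbg ε₀ ε₂₉ B₃ B₃' a₀ a₁ Efl logz
  refine (theta13OfThm1CCMWZB F N j γ εbg ε₀ ε₂₉ B₃ B₃' a₀ a₁ Efl logz).hcompBoth_of_betaBoxSignFree (bl := bl) (β' := β')
    (by rw [theta13OfThm1CCMWZB_A₀]; exact A0OfThm1CC1_nonneg hB hB' ha₀ ha₁) (theta13OfThm1CCMWZB_p₀ F N j γ εbg ε₀ ε₂₉ B₃ B₃' a₀ a₁ Efl logz) (by rw [hγ']; exact hγ)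
    (by rw [theta13OfThm1CCMWZB_cR]; norm_num) (by rw [hγ']; exact hlow) (by rw [hγ']; exact hup) ?_ ?_
  · rw [hγ']; exact hl
  · rw [hγ']; exact hu

/-- **★★ʷ THE SAME FROM THE SIGN-FREE BOX OF THE HALF-WINDOW MEMBER `β₁₃(θ₁₅ᶜᶜᴹᵂᶻᴮ(j; ½; εbg))` ON `]0, γ]`** (§5 transfer `betaLowerH∕betaUpperH_theta13OfThm1CCMWZB_of_half`).  These hypotheses are the
WINDOWED TWO-SIDED BOX WITH LETTERS — dag-n21-c's 3ʷ text with `0 ≤ b` replaced by the letter `−b·γ² ≤ 3`.  CONDITIONAL.  (node O P3 g48 §4ʷ at Z3.) [cite: Balaban1987RG1, (1.20)–(1.22) p.264, (0.20) p.256, §1 p.264; Balaban1988Convergent, (2.4)–(2.8) pp.255–256] -/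
theorem hcompBoth_theta13OfThm1CCMWZB_of_betaBoxSignFree_half (hγ : γ ≤ 1 / 2) (hB : 0 ≤ B₃) (hB' : 0 ≤ B₃') (ha₀ : 0 ≤ a₀) (ha₁ : 0 ≤ a₁) {bl β' : ℝ}
    (hlow : BetaLowerH bl γ (betaOfRecord₁₃ F N (theta13OfThm1CCMWZB F N j (1 / 2) εbg ε₀ ε₂₉ B₃ B₃' a₀ a₁ Efl logz)))
    (hup : BetaUpperH β' γ (betaOfRecord₁₃ F N (theta13OfThm1CCMWZB F N j (1 / 2) εbg ε₀ ε₂₉ B₃ B₃' a₀ a₁ Efl logz))) (hl : -bl * γ ^ 2 ≤ 3) (hu : β' * γ ^ 2 ≤ 3 / 4) :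
    (∀ (p : B12.RunParams) (n : ℕ), n ≤ p.K → Step.InInterval (theta13OfThm1CCMWZB F N j γ εbg ε₀ ε₂₉ B₃ B₃' a₀ a₁ Efl logz).γ n (gOfRecord₁₃ F N (theta13OfThm1CCMWZB F N j γ εbg ε₀ ε₂₉ B₃ B₃' a₀ a₁ Efl logz) p) → ∀ m, m < n →
      (theta13OfThm1CCMWZB F N j γ εbg ε₀ ε₂₉ B₃ B₃' a₀ a₁ Efl logz).s2.cR * epsOfRecord (theta13OfThm1CCMWZB F N j γ εbg ε₀ ε₂₉ B₃ B₃' a₀ a₁ Efl logz).ν (gOfRecord₁₃ F N (theta13OfThm1CCMWZB F N j γ εbg ε₀ ε₂₉ B₃ B₃' a₀ a₁ Efl logz) p) m ≤ 2 * ((theta13OfThm1CCMWZB F N j γ εbg ε₀ ε₂₉ B₃ B₃' a₀ a₁ Efl logz).s2.cR * epsOfRecord (theta13OfThm1CCMWZB F N j γ εbg ε₀ ε₂₉ B₃ B₃' a₀ a₁ Efl logz).ν (gOfRecord₁₃ F N (theta13OfThm1CCMWZB F N j γ εbg ε₀ ε₂₉ B₃ B₃' a₀ a₁ Efl logz) p)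 (m + 1))) ∧
    (∀ (p : B12.RunParams) (n : ℕ), n ≤ p.K → Step.InInterval (theta13OfThm1CCMWZB F N j γ εbg ε₀ ε₂₉ B₃ B₃' a₀ a₁ Efl logz).γ n (gOfRecord₁₃ F N (theta13OfThm1CCMWZB F N j γ εbg ε₀ ε₂₉ B₃ B₃' a₀ a₁ Efl logz) p) → ∀ m, m < n →
      (theta13OfThm1CCMWZB F N j γ εbg ε₀ ε₂₉ B₃ B₃' a₀ a₁ Efl logz).s2.cR * epsOfRecord (theta13OfThm1CCMWZB F N j γ εbg ε₀ ε₂₉ B₃ B₃' a₀ a₁ Efl logz).ν (gOfRecord₁₃ F N (theta13OfThm1CCMWZB F N j γ εbg ε₀ ε₂₉ B₃ B₃' a₀ a₁ Efl logz) p) (m + 1) ≤ 2 * ((theta13OfThm1CCMWZB F N j γ εbg ε₀ ε₂₉ B₃ B₃' a₀ a₁ Efl logz).s2.cR * epsOfRecord (theta13OfThm1CCMWZB F N j γ εbg ε₀ ε₂₉ B₃ B₃' a₀ a₁ Efl logz).ν (gOfRecord₁₃ F N (theta13OfThm1CCMWZB F N j γ εbg ε₀ ε₂₉ B₃ B₃'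 a₀ a₁ Efl logz) p) m)) :=
  hcompBoth_theta13OfThm1CCMWZB_of_betaBoxSignFree hγ hB hB' ha₀ ha₁ (betaLowerH_theta13OfThm1CCMWZB_of_half hγ hlow) (betaUpperH_theta13OfThm1CCMWZB_of_half hγ hup) hl hu

end SignFree

/-! ## §7. Kernel sanity (nothing declared): at `εbg := 1` the letters are A2ʷ-Z's statements (Z3's bridge `theta13OfThm1CCMWZ_eq_B`, `rfl`); the print-regime member `εbg := a₀` -/

section Sanity

variable (F : T4Family) (N : ℕ) [NeZero N] (j : ℕ) (γ ε₀ ε₂₉ B₃ B₃' a₀ a₁ : ℝ) (Efl logz : B12.RunParams → ℕ → ℝ)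

/-- SANITY (kernel): A2ʷ-Z's pin `hM` at `θ₁₅ᶜᶜᴹᵂᶻ(j; γ)` IS the `εbg := 1` instance of §4's (Z3 bridge, `rfl`). [cite: Balaban1987RG1, (0.21) p.256 (bookkeeping)] -/
example : ∃ a : ℕ, (theta13OfThm1CCMWZ F N j γ ε₀ ε₂₉ B₃ B₃' a₀ a₁ Efl logz).τ9.M = F.L ^ a :=
  hM_theta13OfThm1CCMWZB F N j γ 1 ε₀ ε₂₉ B₃ B₃' a₀ a₁ Efl logz

/-- SANITY (kernel): the β transfer at the PRINT-REGIME member `εbg := a₀` (the member N09's tower `…N09TowerOfNumericsAtThm1CCMWZB` reads; Z3 §5), `γ ≤ ½`. [cite: Balaban1987RG1, (1.20)–(1.22) p.264, Thm 1 p.259 (bookkeeping)] -/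
example (hγ : γ ≤ 1 / 2) {k : ℕ} {v : Fin (k + 1) → ℝ} (hv : v ∈ Box γ k) :
    betaOfRecord₁₃ F N (theta13OfThm1CCMWZB F N j γ a₀ ε₀ ε₂₉ B₃ B₃' a₀ a₁ Efl logz) k v =
      betaOfRecord₁₃ F N (theta13OfThm1CCMWZB F N j (1 / 2) a₀ ε₀ ε₂₉ B₃ B₃' a₀ a₁ Efl logz) k v :=
  betaOfRecord₁₃_theta13OfThm1CCMWZB_eq_of_mem hγ hv

end Sanity

end Literature.MathematicalPhysics.QuantumFieldTheory.Balaban1983to89.Node00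

end
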